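import Mathlib
import Summits.Ventures.PercRepro2.Defs
import Summits.Ventures.PercRepro2.Graph
import Summits.Ventures.PercRepro2.OneColourSwitch
import Summits.Ventures.PercRepro2.RegionHubSign
import Summits.Ventures.PercRepro2.SideSwitch
import Summits.Ventures.PercRepro2.TermSwitchDefs
import Summits.Ventures.PercRepro2.TermSwitchReach
import Summits.Ventures.PercRepro2.M9NoPocketDefs
import Summits.Ventures.PercRepro2.M9GeneralDSplit

/-!
# The `W`-world switch on a `K`-side point (blind cell PercRepro2, p3 g30, 2026-08-28;
`proofs/P3-HDR.md` §4)

On a colouring with `Sep`, `DOne(d)`, `d ∈ K₂ ∖ M₂`, let `S ⊆ M₂ ∖ {r, s}` be **closed** in the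
`W`-world (every edge from `S` to a vertex of `M₂ ∖ {r, s}` stays in `S` — a union of components
of the subgraph induced on `M₂ ∖ {r, s}` with ALL edges).  Flipping every edge touching `S`
(`flipTouch`) moves `S` from the `W`-world to the `Y`-world and nothing else: `K₂' = K₂ ∪ S`
(`K2_flipTouch`), `M₂' = M₂ ∖ S` (`M2_flipTouch`), so `Sep`, `DOne`, `d ∈ K₂' ∖ M₂'` survive
(`sep2_flipTouch`, `DOne_flipTouch`); the `W`-cluster of `d` only grows (`conn_compl_d_flipTouch`),
so a hub–dead-end colouring stays one (`HD_flipTouch`); and the colour preference of `p, q` does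
not increase (`sigma_flipTouch_le`: `Y`-paths of the image avoid `S`, `W`-paths of the source
avoid `S`).  If the `W`-edges touching `S` already join `r` to `s` (`wIn`), the image has `r ~_Y s`
(`conn_rs_flipTouch_of_wIn`); if no `W`-path avoiding `S` joins `r` to `s` (`wOut`), the image has
`r ≁_W s` (`not_conn_compl_rs_flipTouch_of_wOut`).  With `S` = the linking components of the
`W`-world this is the switch `ψ` of `proofs/P3-HDR.md` §4 that sends every `W`-only hub–dead-end
colouring to a `Y`-only one with a smaller `σ_pq`.  Own work; std axioms.
-/

namespace Summit.Ventures.PercRepro2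

namespace NoPocket

open Finset Classical RegionHub OneColourSwitch SideSwitch TermSwitch

variable {V : Type*} {E : Type*}

section Switch

variable {ends : E → Sym2 V} {p q r s d : V} {ω : Config E} {S : Set V}

/-- The `W`-edges touching `S`, as a configuration. -/
noncomputable def wIn (ends : E → Sym2 V) (S : Set V) (ω : Config E) : Config E :=
  fun e => if e ∈ touches ends S then !ω e else false

/-- The `W`-edges not touching `S`, as a configuration. -/
noncomputable def wOut (ends : E → Sym2 V) (S : Set V) (ω : Config E) : Config E :=
  fun e => if e ∈ touches ends S then false else !ω e

/-- **No edge joins `M₂ ∖ {r, s}` to `K₂ ∖ {r, s}`** on a `Sep ∧ DOne` colouring with `d ∉ M₂`. -/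
lemma no_edge_M2_K2 (hD : DOne ends r s d ω) (hM : d ∉ M2 ends r s ω) {e : E} {x y : V}
    (hends : ends e = s(x, y)) (hx : x ∈ M2 ends r s ω) (hxr : x ≠ r) (hxs : x ≠ s)
    (hy : y ∈ K2 ends r s ω) (hyr : y ≠ r) (hys : y ≠ s) : False := by
  by_cases he : ω e = true
  · have hxK : x ∈ K2 ends r s ω := mem_K2_of_open hy he (by rw [hends, Sym2.eq_swap])
    have hxd : x ≠ d := by rintro rfl; exact hM hx
    exact hD x hxr hxs hxd hxK hx
  · rw [Bool.not_eq_true] at he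
    have hyM : y ∈ M2 ends r s ω := mem_M2_of_closed hx he hends
    have hyd : y ≠ d := by rintro rfl; exact hM hyM
    exact hD y hyr hys hyd hy hyM

/-- The hypotheses on `S`: inside the `W`-world away from `r, s`, and closed there. -/
structure WClosed (ends : E → Sym2 V) (r s : V) (ω : Config E) (S : Set V) : Prop where
  subset : ∀ x ∈ S, x ∈ M2 ends r s ω ∧ x ≠ r ∧ x ≠ s
  closed : ∀ e x y, ends e = s(x, y) → x ∈ S → y ∈ M2 ends r s ω → y ≠ r → y ≠ s → y ∈ S

/-- An edge from `S` to `r` or `s` is `W`. -/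
lemma edge_S_rs_false (hD : DOne ends r s d ω) (hM : d ∉ M2 ends r s ω)
    (hS : WClosed ends r s ω S) {e : E} {x y : V} (hends : ends e = s(x, y)) (hx : x ∈ S)
    (hy : y = r ∨ y = s) : ω e = false := by
  by_contra he
  rw [Bool.not_eq_false] at he
  obtain ⟨hxM, hxr, hxs⟩ := hS.subset x hx
  have hyK : y ∈ K2 ends r s ω := by
    rcases hy with rfl | rfl
    · exact r_mem_K2 _ _ _
    · exact s_mem_K2 _ _ _
  have hxK : x ∈ K2 ends r s ω := mem_K2_of_open hyK he (by rw [hends, Sym2.eq_swap])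
  have hxd : x ≠ d := by rintro rfl; exact hM hxM
  exact hD x hxr hxs hxd hxK hxM

/-- An edge from `S` to a vertex outside the `W`-world is `Y`. -/
lemma edge_S_out_true (hS : WClosed ends r s ω S) {e : E} {x y : V} (hends : ends e = s(x, y))
    (hx : x ∈ S) (hy : y ∉ M2 ends r s ω) : ω e = true := by
  by_contra he
  rw [Bool.not_eq_true] at he
  exact hy (mem_M2_of_closed (hS.subset x hx).1 he hends)

/-- `r`, `s`, `d` and the `Y`-world lie outside `S`. -/
lemma not_mem_S_of_mem_K2 (hD : DOne ends r s d ω) (hM : d ∉ M2 ends r s ω)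
    (hS : WClosed ends r s ω S) {x : V} (hx : x ∈ K2 ends r s ω) : x ∉ S := by
  intro hxS
  obtain ⟨hxM, hxr, hxs⟩ := hS.subset x hxS
  have hxd : x ≠ d := by rintro rfl; exact hM hxM
  exact hD x hxr hxs hxd hx hxM

/-- `flipTouch` on an edge touching `S` (colour form). -/
lemma flipTouch_eq_of_mem {e : E} (h : e ∈ touches ends S) :
    flipTouch ends S ω e = !ω e := flipTouch_of_mem ends h

/-- **The `Y`-world after the switch** is the old one together with `S`. -/
theorem K2_flipTouch (hD : DOne ends r s d ω) (hM : d ∉ M2 ends r s ω)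
    (hS : WClosed ends r s ω S) :
    K2 ends r s (flipTouch ends S ω) = K2 ends r s ω ∪ S := by
  ext x
  constructor
  · intro hx
    -- closure of `K₂ ∪ S` under `Y`-adjacency of the switched colouring
    have key : ∀ v, v ∈ K2 ends r s ω ∪ S → ∀ y, (openGraph ends (flipTouch ends S ω)).Adj v y →
        y ∈ K2 ends r s ω ∪ S := by
      intro v hv y hvy
      obtain ⟨_, e, he, hends⟩ := openGraph_adj.1 hvy
      by_cases ht : e ∈ touches ends S
      · rw [flipTouch_of_mem ends ht] at he
        have hw : ω e = false := by
          rcases h : ω e with _ | _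
          · rfl
          · rw [h] at he; exact absurd he (by decide)
        obtain ⟨z, hz, w, hzw⟩ := ht
        -- the edge has an end in `S`
        by_cases hyS : y ∈ S
        · exact Or.inr hyS
        · have hvS : v ∈ S := by
            rw [hends, Sym2.eq_iff] at hzw
            rcases hzw with ⟨rfl, _⟩ | ⟨_, rfl⟩
            · exact hz
            · exact absurd hz hyS
          have hyM : y ∈ M2 ends r s ω := mem_M2_of_closed (hS.subset v hvS).1 hw hends
          by_cases hyr : y = r
          · exact Or.inl (hyr ▸ r_mem_K2 _ _ _)
          by_cases hys : y = s
          · exact Or.inl (hys ▸ s_mem_K2 _ _ _)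
          exact Or.inr (hS.closed e v y hends hvS hyM hyr hys)
      · rw [flipTouch_of_notMem ends ht] at he
        rcases hv with hvK | hvS
        · exact Or.inl (mem_K2_of_open hvK he hends)
        · exact absurd (mem_touches_of_ends hends (Or.inl hvS)) ht
    rcases mem_K2_iff.1 hx with hc | hc
    · exact mem_of_conn_of_closed key (Or.inl (r_mem_K2 _ _ _)) hc
    · exact mem_of_conn_of_closed key (Or.inl (s_mem_K2 _ _ _)) hc
  · rintro (hx | hx)
    · -- old `Y`-paths avoid `S`
      have key : ∀ v, v ∈ K2 ends r s (flipTouch ends S ω) ∩ K2 ends r s ω → ∀ y,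
          (openGraph ends ω).Adj v y → y ∈ K2 ends r s (flipTouch ends S ω) ∩ K2 ends r s ω := by
        intro v ⟨hv', hv⟩ y hvy
        obtain ⟨_, e, he, hends⟩ := openGraph_adj.1 hvy
        have hyK : y ∈ K2 ends r s ω := mem_K2_of_open hv he hends
        have ht : e ∉ touches ends S := by
          rintro ⟨z, hz, w, hzw⟩
          rw [hends, Sym2.eq_iff] at hzw
          rcases hzw with ⟨rfl, _⟩ | ⟨_, rfl⟩
          · exact not_mem_S_of_mem_K2 hD hM hS hv hz
          · exact not_mem_S_of_mem_K2 hD hM hS hyK hz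
        have he' : flipTouch ends S ω e = true := by rw [flipTouch_of_notMem ends ht]; exact he
        exact ⟨mem_K2_of_open hv' he' hends, hyK⟩
      rcases mem_K2_iff.1 hx with hc | hc
      · exact (mem_of_conn_of_closed key ⟨r_mem_K2 _ _ _, r_mem_K2 _ _ _⟩ hc).1
      · exact (mem_of_conn_of_closed key ⟨s_mem_K2 _ _ _, s_mem_K2 _ _ _⟩ hc).1
    · -- a vertex of `S`: its old `W`-path from `r` or `s` enters `S` from the terminal
      have key : ∀ v, v ∈ {y | y ∈ M2 ends r s ω ∧ (y ∈ S → y ∈ K2 ends r s (flipTouch ends S ω))} →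
          ∀ y, (openGraph ends (OneColourSwitch.compl ω)).Adj v y →
            y ∈ {y | y ∈ M2 ends r s ω ∧ (y ∈ S → y ∈ K2 ends r s (flipTouch ends S ω))} := by
        intro v ⟨hvM, hv⟩ y hvy
        obtain ⟨_, e, he, hends⟩ := openGraph_adj.1 hvy
        have hw : ω e = false := by
          simp only [OneColourSwitch.compl, Bool.not_eq_true'] at he
          exact he
        have hyM : y ∈ M2 ends r s ω := mem_M2_of_closed hvM hw hends
        refine ⟨hyM, fun hyS => ?_⟩
        have he' : flipTouch ends S ω e = true := by
          rw [flipTouch_of_mem ends (mem_touches_of_ends hends (Or.inr hyS)), hw]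
          rfl
        by_cases hvS : v ∈ S
        · exact mem_K2_of_open (hv hvS) he' hends
        · -- `v ∉ S` adjacent to `y ∈ S`: `v` is `r` or `s`
          by_cases hvr : v = r
          · exact mem_K2_of_open (hvr ▸ r_mem_K2 _ _ _) he' hends
          by_cases hvs : v = s
          · exact mem_K2_of_open (hvs ▸ s_mem_K2 _ _ _) he' hends
          exact absurd (hS.closed e y v (by rw [hends, Sym2.eq_swap]) hyS hvM hvr hvs) hvS
      obtain ⟨hxM, _, _⟩ := hS.subset x hx
      rcases mem_M2_iff.1 hxM with hc | hc
      · exact (mem_of_conn_of_closed key ⟨r_mem_M2 _ _ _, fun h =>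
          absurd rfl (hS.subset r h).2.1⟩ hc).2 hx
      · exact (mem_of_conn_of_closed key ⟨s_mem_M2 _ _ _, fun h =>
          absurd rfl (hS.subset s h).2.2⟩ hc).2 hx

/-- **The `W`-world after the switch** is the old one without `S`. -/
theorem M2_flipTouch (hD : DOne ends r s d ω) (hM : d ∉ M2 ends r s ω)
    (hS : WClosed ends r s ω S) :
    M2 ends r s (flipTouch ends S ω) = M2 ends r s ω \ S := by
  ext x
  constructor
  · intro hx
    have key : ∀ v, v ∈ M2 ends r s ω \ S → ∀ y,
        (openGraph ends (OneColourSwitch.compl (flipTouch ends S ω))).Adj v y →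
          y ∈ M2 ends r s ω \ S := by
      intro v ⟨hvM, hvS⟩ y hvy
      obtain ⟨_, e, he, hends⟩ := openGraph_adj.1 hvy
      have he' : flipTouch ends S ω e = false := by
        simp only [OneColourSwitch.compl, Bool.not_eq_true'] at he
        exact he
      by_cases ht : e ∈ touches ends S
      · rw [flipTouch_of_mem ends ht] at he'
        have hw : ω e = true := by
          rcases h : ω e with _ | _
          · rw [h] at he'; exact absurd he' (by decide)
          · rfl
        obtain ⟨z, hz, w, hzw⟩ := ht
        have hyS : y ∈ S := by
          rw [hends, Sym2.eq_iff] at hzw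
          rcases hzw with ⟨rfl, _⟩ | ⟨_, rfl⟩
          · exact absurd hz hvS
          · exact hz
        exfalso
        by_cases hvr : v = r ∨ v = s
        · have := edge_S_rs_false hD hM hS (by rw [hends, Sym2.eq_swap]) hyS hvr
          rw [hw] at this; exact absurd this (by decide)
        · exact hvS (hS.closed e y v (by rw [hends, Sym2.eq_swap]) hyS hvM
            (fun h => hvr (Or.inl h)) (fun h => hvr (Or.inr h)))
      · rw [flipTouch_of_notMem ends ht] at he'
        refine ⟨mem_M2_of_closed hvM he' hends, fun hyS => ht (mem_touches_of_ends hends (Or.inr hyS))⟩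
    rcases mem_M2_iff.1 hx with hc | hc
    · exact mem_of_conn_of_closed key ⟨r_mem_M2 _ _ _, fun h => absurd rfl (hS.subset r h).2.1⟩ hc
    · exact mem_of_conn_of_closed key ⟨s_mem_M2 _ _ _, fun h => absurd rfl (hS.subset s h).2.2⟩ hc
  · rintro ⟨hx, hxS⟩
    have key : ∀ v, v ∈ {y | y ∈ M2 ends r s ω ∧ (y ∉ S → y ∈ M2 ends r s (flipTouch ends S ω))} →
        ∀ y, (openGraph ends (OneColourSwitch.compl ω)).Adj v y →
          y ∈ {y | y ∈ M2 ends r s ω ∧ (y ∉ S → y ∈ M2 ends r s (flipTouch ends S ω))} := by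
      intro v ⟨hvM, hv⟩ y hvy
      obtain ⟨_, e, he, hends⟩ := openGraph_adj.1 hvy
      have hw : ω e = false := by
        simp only [OneColourSwitch.compl, Bool.not_eq_true'] at he
        exact he
      have hyM : y ∈ M2 ends r s ω := mem_M2_of_closed hvM hw hends
      refine ⟨hyM, fun hyS => ?_⟩
      by_cases hvS : v ∈ S
      · -- `y ∉ S` adjacent to `v ∈ S`: `y` is `r` or `s`
        by_cases hyr : y = r
        · exact hyr ▸ r_mem_M2 _ _ _
        by_cases hys : y = s
        · exact hys ▸ s_mem_M2 _ _ _
        exact absurd (hS.closed e v y hends hvS hyM hyr hys) hyS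
      · have ht : e ∉ touches ends S := by
          rintro ⟨z, hz, w, hzw⟩
          rw [hends, Sym2.eq_iff] at hzw
          rcases hzw with ⟨rfl, _⟩ | ⟨_, rfl⟩
          · exact hvS hz
          · exact hyS hz
        have he' : flipTouch ends S ω e = false := by rw [flipTouch_of_notMem ends ht]; exact hw
        exact mem_M2_of_closed (hv hvS) he' hends
    rcases mem_M2_iff.1 hx with hc | hc
    · exact (mem_of_conn_of_closed key ⟨r_mem_M2 _ _ _, fun _ => r_mem_M2 _ _ _⟩ hc).2 hxS
    · exact (mem_of_conn_of_closed key ⟨s_mem_M2 _ _ _, fun _ => s_mem_M2 _ _ _⟩ hc).2 hxS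

/-- `p, q` stay outside both worlds: **`Sep` survives the switch**. -/
theorem sep2_flipTouch (hsep : sep2 ends p q r s ω) (hD : DOne ends r s d ω)
    (hM : d ∉ M2 ends r s ω) (hS : WClosed ends r s ω S) :
    sep2 ends p q r s (flipTouch ends S ω) := by
  obtain ⟨hpK, hqK⟩ := not_mem_K2_of_sep2 hsep
  obtain ⟨hpM, hqM⟩ := not_mem_M2_of_sep2 hsep
  have hpK' : p ∉ K2 ends r s (flipTouch ends S ω) := by
    rw [K2_flipTouch hD hM hS]
    rintro (h | h)
    · exact hpK h
    · exact hpM (hS.subset p h).1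
  have hqK' : q ∉ K2 ends r s (flipTouch ends S ω) := by
    rw [K2_flipTouch hD hM hS]
    rintro (h | h)
    · exact hqK h
    · exact hqM (hS.subset q h).1
  have hpM' : p ∉ M2 ends r s (flipTouch ends S ω) := by
    rw [M2_flipTouch hD hM hS]
    exact fun h => hpM h.1
  have hqM' : q ∉ M2 ends r s (flipTouch ends S ω) := by
    rw [M2_flipTouch hD hM hS]
    exact fun h => hqM h.1
  refine ⟨⟨?_, ?_, ?_, ?_⟩, ⟨?_, ?_, ?_, ?_⟩⟩
  · exact fun h => hpK' (mem_K2_iff.2 (Or.inl (conn_symm h)))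
  · exact fun h => hpK' (mem_K2_iff.2 (Or.inr (conn_symm h)))
  · exact fun h => hqK' (mem_K2_iff.2 (Or.inl (conn_symm h)))
  · exact fun h => hqK' (mem_K2_iff.2 (Or.inr (conn_symm h)))
  · exact fun h => hpM' (mem_M2_iff.2 (Or.inl (conn_symm h)))
  · exact fun h => hpM' (mem_M2_iff.2 (Or.inr (conn_symm h)))
  · exact fun h => hqM' (mem_M2_iff.2 (Or.inl (conn_symm h)))
  · exact fun h => hqM' (mem_M2_iff.2 (Or.inr (conn_symm h)))

/-- **`DOne` survives the switch.** -/
theorem DOne_flipTouch (hD : DOne ends r s d ω) (hM : d ∉ M2 ends r s ω)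
    (hS : WClosed ends r s ω S) : DOne ends r s d (flipTouch ends S ω) := by
  intro x hxr hxs hxd hxK hxM
  rw [K2_flipTouch hD hM hS] at hxK
  rw [M2_flipTouch hD hM hS] at hxM
  rcases hxK with hxK | hxS
  · exact hD x hxr hxs hxd hxK hxM.1
  · exact hxM.2 hxS

/-- `d` stays on the `K`-side. -/
theorem mem_K2_flipTouch_of_mem (hD : DOne ends r s d ω) (hM : d ∉ M2 ends r s ω)
    (hS : WClosed ends r s ω S) (hK : d ∈ K2 ends r s ω) :
    d ∈ K2 ends r s (flipTouch ends S ω) := by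
  rw [K2_flipTouch hD hM hS]; exact Or.inl hK

/-- `d` stays outside the `W`-world. -/
theorem not_mem_M2_flipTouch (hD : DOne ends r s d ω) (hM : d ∉ M2 ends r s ω)
    (hS : WClosed ends r s ω S) : d ∉ M2 ends r s (flipTouch ends S ω) := by
  rw [M2_flipTouch hD hM hS]; exact fun h => hM h.1

/-- **The `W`-cluster of `d` only grows**: a `W`-path from `d` never touches `S`. -/
theorem conn_compl_d_flipTouch (hM : d ∉ M2 ends r s ω) (hS : WClosed ends r s ω S) {x : V}
    (hc : Conn ends (OneColourSwitch.compl ω) d x) :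
    Conn ends (OneColourSwitch.compl (flipTouch ends S ω)) d x := by
  have hdS : d ∉ S := fun h => hM (hS.subset d h).1
  have key : ∀ v, v ∈ {y | Conn ends (OneColourSwitch.compl (flipTouch ends S ω)) d y ∧ y ∉ S ∧
      Conn ends (OneColourSwitch.compl ω) d y} → ∀ y,
      (openGraph ends (OneColourSwitch.compl ω)).Adj v y →
        y ∈ {y | Conn ends (OneColourSwitch.compl (flipTouch ends S ω)) d y ∧ y ∉ S ∧
          Conn ends (OneColourSwitch.compl ω) d y} := by
    intro v ⟨hv', hvS, hvd⟩ y hvy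
    obtain ⟨_, e, he, hends⟩ := openGraph_adj.1 hvy
    have hw : ω e = false := by
      simp only [OneColourSwitch.compl, Bool.not_eq_true'] at he
      exact he
    have hyd : Conn ends (OneColourSwitch.compl ω) d y :=
      conn_trans hvd (conn_of_openAdj ⟨e, he, hends⟩)
    have hyS : y ∉ S := by
      intro hyS
      have hvM : v ∈ M2 ends r s ω :=
        mem_M2_of_closed (hS.subset y hyS).1 hw (by rw [hends, Sym2.eq_swap])
      apply hM
      rcases mem_M2_iff.1 hvM with h | h
      · exact mem_M2_iff.2 (Or.inl (conn_trans h (conn_symm hvd)))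
      · exact mem_M2_iff.2 (Or.inr (conn_trans h (conn_symm hvd)))
    have ht : e ∉ touches ends S := by
      rintro ⟨z, hz, w, hzw⟩
      rw [hends, Sym2.eq_iff] at hzw
      rcases hzw with ⟨rfl, _⟩ | ⟨_, rfl⟩
      · exact hvS hz
      · exact hyS hz
    have he' : OneColourSwitch.compl (flipTouch ends S ω) e = true := by
      simp only [OneColourSwitch.compl, flipTouch_of_notMem ends ht, hw]
      rfl
    exact ⟨conn_trans hv' (conn_of_openAdj ⟨e, he', hends⟩), hyS, hyd⟩
  exact (mem_of_conn_of_closed key ⟨conn_refl _ _ _, hdS, conn_refl _ _ _⟩ hc).1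

end Switch

end NoPocket

end Summit.Ventures.PercRepro2
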